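import Summits.AtomisticToContinuum.Crystallization.Theorems.ExcessDecayLiouvilleHcpLiouvilleAnchorNewton
import Summits.AtomisticToContinuum.Crystallization.Theorems.ExcessDecayLiouvilleLatticeSumConst
import Summits.AtomisticToContinuum.Crystallization.Theorems.ExcessDecayLiouvilleAffineFields
import Summits.AtomisticToContinuum.Crystallization.Theorems.ExcessDecayLiouvilleCutoff
import Summits.AtomisticToContinuum.Crystallization.Theorems.ExcessDecayLiouvilleCaccioppoli
import Summits.AtomisticToContinuum.Crystallization.Theorems.ExcessDecayLiouvilleHcpLiouvilleGeometry
import Summits.AtomisticToContinuum.Crystallization.Theorems.ExcessDecayLiouvilleVerticalDifferences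
import Summits.AtomisticToContinuum.Crystallization.Theorems.ExcessDecayLiouvilleLatticeCoordinates

/-!
# Route `ExcessDecayLiouville`: the cross force-constant operator and the optical test field (relaxation, I)

Harmonic-replacement architecture for item `ExcessDecay` (stmt-AtomisticToContinuum-9334), nonlinear half.
The approximants of the excess-decay iteration are internally RELAXED affine two-lattices; the relaxed inner
shift is produced by a contraction whose linear part is the **cross force-constant operator** of the
reference datum `(t, A)`,

`M = Σ'_{q ∈ S₁} K(t 0 − q)`  (`S₁ = t 1 + AΛ₀`, `K = forceConst`),

an absolutely convergent operator-valued lattice sum (`summable_crossFC`, `crossFC_apply`).  Its coercivity is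
extracted from the harmonic-stability hypothesis `κ · nnForm ≤ Σ' ⟪L v, v⟫` with the optical test field
`u = η · 𝟙_{S₀} · β` (`η` a Lipschitz site cut-off at scale `L ~ 1/κ`): the rows of `u` are `η_p · Mβ` plus a
same-sublattice commutator of size `O(1/L)` (`opRow_testField`, `norm_commRow_le`), the strain form of `u`
counts at least one cross neighbour per site (`nnForm_testField_ge`); the coercivity itself is assembled in
`ExcessDecayLiouvilleRelaxationCoercive.lean`.
All `[folklore]`; helper lemmas, nothing here closes an item.
-/

noncomputable section

namespace Summit.AtomisticToContinuum.Crystallization.Theorems.ExcessDecayLiouville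

open scoped BigOperators Topology InnerProductSpace RealInnerProductSpace Classical
open Literature.MathematicalPhysics.StatisticalMechanics
open Summit.AtomisticToContinuum.Crystallization.Theorems.PhononStabilityNegative

local notation "E3" => EuclideanSpace ℝ (Fin 3)

-- Local notation: the force-constant map `K(e)w = h(|e|²)w + 2⟪e,w⟫h′(|e|²)e` (`= forceConst e w`).
local notation3 "𝕂[" e "] " w:max =>
  (-((‖e‖ ^ 2)⁻¹) ^ 7 + ((‖e‖ ^ 2)⁻¹) ^ 4) • w + (2 * ⟪e, w⟫ * (7 * ((‖e‖ ^ 2)⁻¹) ^ 8 - 4 * ((‖e‖ ^ 2)⁻¹) ^ 5)) • e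

section

variable {t : Fin 2 → E3} {A : E3 →L[ℝ] E3} {κ : ℝ}

set_option quotPrecheck false in
-- Local notation: the operator row `(L v)(p)`.
local notation "𝕃" v:max " @ " p:max =>
  tsum (fun q : Sites₀ t A => (if ((p : Sites₀ t A) : E3) ≠ q then 𝕂[((p : Sites₀ t A) : E3) - q] (v ((p : Sites₀ t A) : E3) - v q) else 0))

set_option quotPrecheck false in
-- Local notation: the cross force-constant operator `M = Σ'_{q ∈ S₁} K(t 0 − q)`.
local notation "𝐌ₓ" =>
  tsum (fun q : Sites₀ t A => (if (∃ z ∈ Λ₀, (q : E3) = t 1 + A z) then forceConst ((t 0 : E3) - q) else 0))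

/-! ## The cross force-constant operator -/

/-- `t 0` is a site. [folklore] -/
theorem t0_mem_sites : t 0 ∈ Sites₀ t A := ⟨0, 0, zero_mem_Λ₀, by simp⟩

/-- A site of sublattice `1` is not `t 0 + A z`. [folklore] -/
theorem ne_of_mem_one (hA : Adm₀ A) (hI : Inner₀ t A) {q : E3} (hq : ∃ z ∈ Λ₀, q = t 1 + A z)
    {z₀ : E3} (hz₀ : z₀ ∈ Λ₀) : t 0 + A z₀ ≠ q := by
  obtain ⟨z, hz, rfl⟩ := hq
  exact sublattice_ne hA hI hz₀ hz

/-- Norm bound for the summands of `M`: `‖K(p − q)‖ ≤ 38 (25/23) (dist q p)⁻⁷` at sites `q ≠ p`. [folklore] -/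
theorem norm_forceConst_sites_le (hA : Adm₀ A) (hI : Inner₀ t A) {p : E3} (hp : p ∈ Sites₀ t A) (q : Sites₀ t A)
    (hpq : p ≠ q) : ‖forceConst (p - q)‖ ≤ 38 * (25 / 23) * (dist (q : E3) p)⁻¹ ^ 7 := by
  have hd : 23 / 25 ≤ dist (q : E3) p := dist_sites_ge hA hI q.2 hp (Ne.symm hpq)
  have hn : ‖p - (q : E3)‖ = dist (q : E3) p := by rw [dist_comm, dist_eq_norm]
  have h1 := norm_forceConst_le (w := p - (q : E3)) (by rw [hn]; linarith)
  rw [hn] at h1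
  refine h1.trans ?_
  have h0 : 0 < dist (q : E3) p := by linarith
  have hi : (dist (q : E3) p)⁻¹ ≤ 25 / 23 := by
    rw [inv_le_comm₀ h0 (by norm_num)]; linarith
  have hi0 : 0 ≤ (dist (q : E3) p)⁻¹ := inv_nonneg.2 h0.le
  calc 38 * (dist (q : E3) p)⁻¹ ^ 8 = 38 * (dist (q : E3) p)⁻¹ * (dist (q : E3) p)⁻¹ ^ 7 := by ring
    _ ≤ 38 * (25 / 23) * (dist (q : E3) p)⁻¹ ^ 7 := by gcongr

/-- **Summability of the cross force-constant family** (operator norm `≤ 38 |·|⁻⁸`). [folklore] -/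
theorem summable_crossFC (hA : Adm₀ A) (hI : Inner₀ t A) :
    Summable (fun q : Sites₀ t A => (if (∃ z ∈ Λ₀, (q : E3) = t 1 + A z) then forceConst ((t 0 : E3) - q) else 0)) := by
  have h7 := (summable_inv_pow_seven_sites hA hI (t0_mem_sites (t := t) (A := A))).1
  refine Summable.of_norm_bounded (h7.mul_left (38 * (25 / 23))) fun q => ?_
  by_cases hq : ∃ z ∈ Λ₀, (q : E3) = t 1 + A z
  · have hne : t 0 ≠ (q : E3) := by
      have := ne_of_mem_one hA hI hq zero_mem_Λ₀; simpa using this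
    rw [if_pos hq, if_pos (Ne.symm hne)]
    exact norm_forceConst_sites_le hA hI t0_mem_sites q hne
  · rw [if_neg hq, norm_zero]
    split_ifs <;> positivity

/-- **`M` applied to a vector** is the lattice sum of the `K(t 0 − q) β`. [folklore] -/
theorem crossFC_apply (hA : Adm₀ A) (hI : Inner₀ t A) (β : E3) :
    (𝐌ₓ) β = ∑' q : Sites₀ t A, (if (∃ z ∈ Λ₀, (q : E3) = t 1 + A z) then 𝕂[(t 0 : E3) - q] β else 0) := by
  have h := (ContinuousLinearMap.apply ℝ E3 β).map_tsum (summable_crossFC hA hI)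
  rw [ContinuousLinearMap.apply_apply] at h
  rw [h]
  refine tsum_congr fun q => ?_
  split_ifs
  · rw [ContinuousLinearMap.apply_apply, forceConst_apply]
  · simp

/-- Summability of the applied cross family at a general base site `p`. [folklore] -/
theorem summable_crossRow (hA : Adm₀ A) (hI : Inner₀ t A) (p : Sites₀ t A) (β : E3) :
    Summable (fun q : Sites₀ t A => (if (∃ z ∈ Λ₀, (q : E3) = t 1 + A z) then 𝕂[(p : E3) - q] β else 0)) := by
  have h7 := (summable_inv_pow_seven_sites hA hI p.2).1
  refine Summable.of_norm_bounded (h7.mul_left (38 * (25 / 23) * ‖β‖)) fun q => ?_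
  by_cases hq : ∃ z ∈ Λ₀, (q : E3) = t 1 + A z
  · by_cases hpq : (p : E3) = q
    · -- then `p ∈ S₁` too and the bound is trivial only if we avoid it: use the crude route
      obtain ⟨z, hz, hzq⟩ := hq
      obtain ⟨m, z', hz', hp'⟩ := p.2
      rw [if_pos ⟨z, hz, hzq⟩, if_neg (fun h => h hpq.symm)]
      simp only [mul_zero]
      rw [hpq, sub_self]
      simp
    · rw [if_pos hq, if_pos (Ne.symm hpq), ← forceConst_apply]
      calc ‖forceConst ((p : E3) - q) β‖ ≤ ‖forceConst ((p : E3) - q)‖ * ‖β‖ := ContinuousLinearMap.le_opNorm _ _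
        _ ≤ 38 * (25 / 23) * (dist (q : E3) p)⁻¹ ^ 7 * ‖β‖ := by
            gcongr; exact norm_forceConst_sites_le hA hI p.2 q hpq
        _ = 38 * (25 / 23) * ‖β‖ * (dist (q : E3) p)⁻¹ ^ 7 := by ring
  · rw [if_neg hq, norm_zero]
    split_ifs <;> positivity

/-- **Sublattice constancy of the cross row**: for `p ∈ S₀`, `Σ'_{q∈S₁} K(p − q)β = Mβ`. [folklore] -/
theorem crossRow_eq (hA : Adm₀ A) (hI : Inner₀ t A) (β : E3) {z₀ : E3} (hz₀ : z₀ ∈ Λ₀) :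
    (∑' q : Sites₀ t A, (if (∃ z ∈ Λ₀, (q : E3) = t 1 + A z) then 𝕂[(t 0 + A z₀ : E3) - q] β else 0)) = (𝐌ₓ) β := by
  rw [crossFC_apply hA hI]
  have h := tsum_pair_sublattice_const (t := t) (A := A)
    (fun p q => (if (∃ z ∈ Λ₀, q = t 1 + A z) then 𝕂[p - q] β else 0)) ?_ 0 zero_mem_Λ₀ hz₀
  · simpa using h
  · intro l hl p q
    have e1 : (p : E3) + A l - ((q : E3) + A l) = (p : E3) - q := by abel
    have hiff : (∃ z ∈ Λ₀, (q : E3) + A l = t 1 + A z) ↔ (∃ z ∈ Λ₀, (q : E3) = t 1 + A z) := by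
      constructor
      · rintro ⟨z, hz, h⟩
        have hzl : z - l ∈ Λ₀ := by
          rw [sub_eq_add_neg]; exact hcpLiouvilleLam_add_mem hz (neg_mem_Λ₀ hl)
        refine ⟨z - l, hzl, ?_⟩
        rw [map_sub]
        have : (q : E3) = t 1 + A z - A l := by rw [← h]; abel
        rw [this]; abel
      · rintro ⟨z, hz, h⟩
        exact ⟨z + l, hcpLiouvilleLam_add_mem hz hl, by rw [h, map_add]; abel⟩
    simp only [e1, hiff]

/-! ## The optical test field `u = η · 𝟙_{S₀} · β` -/

/-- Linearity of `K(e)` in the displacement: `K(e)(c • w) = c • K(e) w`, `K(e)(v − w) = K(e)v − K(e)w`. [folklore] -/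
theorem forceConst_smul_sub (e : E3) (a b : ℝ) (β : E3) :
    𝕂[e] (a • β - b • β) = (a - b) • 𝕂[e] β := by
  rw [← forceConst_apply, ← forceConst_apply, ← sub_smul, map_smul]

/-- **Rows of the optical test field.**  For `p ∈ S₀`,
`(L u)(p) = η_p · Σ'_{q ∈ S₁} K(p−q)β + Σ'_{q ∈ S₀, q ≠ p} (η_p − η_q) K(p−q)β`. [folklore] -/
theorem opRow_testField (hA : Adm₀ A) (hI : Inner₀ t A) (η : E3 → ℝ) (hη : ∀ x, |η x| ≤ 1) (β : E3)
    (p : Sites₀ t A) (hp : ∃ z ∈ Λ₀, (p : E3) = t 0 + A z) :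
    𝕃 (fun x => if (∃ z ∈ Λ₀, x = t 0 + A z) then η x • β else 0) @ p =
      η p • (∑' q : Sites₀ t A, (if (∃ z ∈ Λ₀, (q : E3) = t 1 + A z) then 𝕂[(p : E3) - q] β else 0)) +
      ∑' q : Sites₀ t A, (if ((p : E3) ≠ q ∧ ∃ z ∈ Λ₀, (q : E3) = t 0 + A z) then (η p - η q) • 𝕂[(p : E3) - q] β else 0) := by
  obtain ⟨zp, hzp, hpz⟩ := hp
  have hp1 : ¬ ∃ z ∈ Λ₀, (p : E3) = t 1 + A z := by
    rintro ⟨z, hz, h⟩; exact sublattice_ne hA hI hzp hz (hpz.symm.trans h)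
  have hsum1 := summable_crossRow hA hI p β
  have h7 := (summable_inv_pow_seven_sites hA hI p.2).1
  have hsum2 : Summable (fun q : Sites₀ t A => (if ((p : E3) ≠ q ∧ ∃ z ∈ Λ₀, (q : E3) = t 0 + A z) then
      (η p - η q) • 𝕂[(p : E3) - q] β else 0)) := by
    refine Summable.of_norm_bounded (h7.mul_left (2 * (38 * (25 / 23) * ‖β‖))) fun q => ?_
    by_cases hq : (p : E3) ≠ q ∧ ∃ z ∈ Λ₀, (q : E3) = t 0 + A z
    · rw [if_pos hq, if_pos (Ne.symm hq.1), norm_smul, ← forceConst_apply]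
      have h1 : ‖η p - η q‖ ≤ 2 := by
        have := hη p; have := hη q
        rw [Real.norm_eq_abs]; exact (abs_sub _ _).trans (by linarith)
      have h2 : ‖forceConst ((p : E3) - q) β‖ ≤ 38 * (25 / 23) * ‖β‖ * (dist (q : E3) p)⁻¹ ^ 7 :=
        calc ‖forceConst ((p : E3) - q) β‖ ≤ ‖forceConst ((p : E3) - q)‖ * ‖β‖ := ContinuousLinearMap.le_opNorm _ _
          _ ≤ 38 * (25 / 23) * (dist (q : E3) p)⁻¹ ^ 7 * ‖β‖ := by
              gcongr; exact norm_forceConst_sites_le hA hI p.2 q hq.1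
          _ = 38 * (25 / 23) * ‖β‖ * (dist (q : E3) p)⁻¹ ^ 7 := by ring
      have h0 : 0 ≤ 38 * (25 / 23) * ‖β‖ * (dist (q : E3) p)⁻¹ ^ 7 := by positivity
      calc ‖η p - η q‖ * ‖forceConst ((p : E3) - q) β‖ ≤ 2 * (38 * (25 / 23) * ‖β‖ * (dist (q : E3) p)⁻¹ ^ 7) :=
            mul_le_mul h1 h2 (norm_nonneg _) (by norm_num)
        _ = 2 * (38 * (25 / 23) * ‖β‖) * (dist (q : E3) p)⁻¹ ^ 7 := by ring
    · rw [if_neg hq, norm_zero]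
      split_ifs <;> positivity
  rw [← hsum1.tsum_const_smul (η p), ← Summable.tsum_add (hsum1.const_smul _) hsum2]
  refine tsum_congr fun q => ?_
  obtain ⟨m, z, hz, hqz⟩ := q.2
  fin_cases m
  · -- `q ∈ S₀`
    have hq0 : ∃ z ∈ Λ₀, (q : E3) = t 0 + A z := ⟨z, hz, hqz⟩
    have hq1 : ¬ ∃ z' ∈ Λ₀, (q : E3) = t 1 + A z' := by
      rintro ⟨z', hz', h⟩; exact sublattice_ne hA hI hz hz' (hqz.symm.trans h)
    rw [if_neg hq1, smul_zero, zero_add]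
    by_cases hpq : (p : E3) = q
    · rw [if_neg (fun h => h hpq), if_neg (fun h => h.1 hpq)]
    · rw [if_pos hpq, if_pos ⟨hpq, hq0⟩]
      simp only []
      rw [if_pos ⟨zp, hzp, hpz⟩, if_pos hq0, forceConst_smul_sub]
  · -- `q ∈ S₁`
    have hq1 : ∃ z' ∈ Λ₀, (q : E3) = t 1 + A z' := ⟨z, hz, hqz⟩
    have hq0 : ¬ ∃ z' ∈ Λ₀, (q : E3) = t 0 + A z' := by
      rintro ⟨z', hz', h⟩; exact sublattice_ne hA hI hz' hz (h.symm.trans hqz)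
    have hpq : (p : E3) ≠ q := by rw [hpz]; exact ne_of_mem_one hA hI hq1 hzp
    rw [if_pos hpq, if_pos hq1, if_neg (fun h => hq0 h.2), add_zero]
    simp only []
    rw [if_pos ⟨zp, hzp, hpz⟩, if_neg hq0, sub_zero, ← forceConst_apply, ← forceConst_apply, map_smul]

/-- **The same-sublattice commutator is `O(1/L)`**: if `|η_p − η_q| ≤ ‖p − q‖/L` then
`‖Σ'_{q∈S₀, q≠p} (η_p − η_q) K(p−q)β‖ ≤ (38/L) · C₇ · ‖β‖`, `C₇ = 1024/((23/25)³(23/25)⁴)`. [folklore] -/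
theorem norm_commRow_le (hA : Adm₀ A) (hI : Inner₀ t A) (η : E3 → ℝ) {L : ℝ} (hL : 0 < L)
    (hηL : ∀ p q : Sites₀ t A, |η p - η q| ≤ ‖(p : E3) - q‖ / L) (β : E3) (p : Sites₀ t A) :
    ‖∑' q : Sites₀ t A, (if ((p : E3) ≠ q ∧ ∃ z ∈ Λ₀, (q : E3) = t 0 + A z) then (η p - η q) • 𝕂[(p : E3) - q] β else 0)‖ ≤
      38 / L * (1024 / ((23 / 25 : ℝ) ^ 3 * (23 / 25 : ℝ) ^ 4)) * ‖β‖ := by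
  obtain ⟨h7, h7le⟩ := summable_inv_pow_seven_sites hA hI p.2
  have hbd : ∀ q : Sites₀ t A, ‖(if ((p : E3) ≠ q ∧ ∃ z ∈ Λ₀, (q : E3) = t 0 + A z) then (η p - η q) • 𝕂[(p : E3) - q] β else 0)‖ ≤
      38 / L * ‖β‖ * (if (q : E3) ≠ p then (dist (q : E3) p)⁻¹ ^ 7 else 0) := by
    intro q
    by_cases hq : (p : E3) ≠ q ∧ ∃ z ∈ Λ₀, (q : E3) = t 0 + A z
    · rw [if_pos hq, if_pos (Ne.symm hq.1), norm_smul, ← forceConst_apply]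
      have hd : 23 / 25 ≤ dist (q : E3) p := dist_sites_ge hA hI q.2 p.2 (Ne.symm hq.1)
      have hd0 : 0 < dist (q : E3) p := by linarith
      have hn : ‖(p : E3) - q‖ = dist (q : E3) p := by rw [dist_comm, dist_eq_norm]
      have h1 : ‖η p - η q‖ ≤ dist (q : E3) p / L := by rw [Real.norm_eq_abs, ← hn]; exact hηL p q
      have h2 : ‖forceConst ((p : E3) - q) β‖ ≤ 38 * (dist (q : E3) p)⁻¹ ^ 8 * ‖β‖ := by
        have := norm_forceConst_le (w := (p : E3) - q) (by rw [hn]; linarith)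
        rw [hn] at this
        exact (ContinuousLinearMap.le_opNorm _ _).trans (mul_le_mul_of_nonneg_right this (norm_nonneg _))
      calc ‖η p - η q‖ * ‖forceConst ((p : E3) - q) β‖
          ≤ (dist (q : E3) p / L) * (38 * (dist (q : E3) p)⁻¹ ^ 8 * ‖β‖) :=
            mul_le_mul h1 h2 (norm_nonneg _) (by positivity)
        _ = 38 / L * ‖β‖ * ((dist (q : E3) p * (dist (q : E3) p)⁻¹) * (dist (q : E3) p)⁻¹ ^ 7) := by ring
        _ = 38 / L * ‖β‖ * (dist (q : E3) p)⁻¹ ^ 7 := by rw [mul_inv_cancel₀ hd0.ne', one_mul]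
    · rw [if_neg hq, norm_zero]
      split_ifs <;> positivity
  calc ‖∑' q : Sites₀ t A, (if ((p : E3) ≠ q ∧ ∃ z ∈ Λ₀, (q : E3) = t 0 + A z) then (η p - η q) • 𝕂[(p : E3) - q] β else 0)‖
      ≤ ∑' q : Sites₀ t A, 38 / L * ‖β‖ * (if (q : E3) ≠ p then (dist (q : E3) p)⁻¹ ^ 7 else 0) :=
        tsum_of_norm_bounded (h7.mul_left _).hasSum hbd
    _ = 38 / L * ‖β‖ * ∑' q : Sites₀ t A, (if (q : E3) ≠ p then (dist (q : E3) p)⁻¹ ^ 7 else 0) := tsum_mul_left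
    _ ≤ 38 / L * ‖β‖ * (1024 / ((23 / 25 : ℝ) ^ 3 * (23 / 25 : ℝ) ^ 4)) := by gcongr
    _ = 38 / L * (1024 / ((23 / 25 : ℝ) ^ 3 * (23 / 25 : ℝ) ^ 4)) * ‖β‖ := by ring

/-- **The strain form of the test field counts one cross neighbour per site**:
`Σ_{p ∈ T} ‖u p‖² ≤ nnForm u` for every finite set of sites `T`. [folklore] -/
theorem nnForm_testField_ge (hA : Adm₀ A) (hI : Inner₀ t A) (η : E3 → ℝ) (β : E3)
    (hu : (Function.support fun x => if (∃ z ∈ Λ₀, x = t 0 + A z) then η x • β else 0).Finite)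
    (T : Finset (Sites₀ t A)) :
    ∑ p ∈ T, ‖(fun x => if (∃ z ∈ Λ₀, x = t 0 + A z) then η x • β else 0) (p : E3)‖ ^ 2 ≤
      nnForm t A (fun x => if (∃ z ∈ Λ₀, x = t 0 + A z) then η x • β else 0) := by
  unfold nnForm
  have hrows := summable_nnRows hA hI hu
  refine le_trans (Finset.sum_le_sum fun p _ => ?_) (hrows.sum_le_tsum T fun p _ => tsum_nonneg fun q => by positivity)
  have hrow := summable_nnRow hA hI (fun x => if (∃ z ∈ Λ₀, x = t 0 + A z) then η x • β else 0) p
  by_cases hp : ∃ z ∈ Λ₀, (p : E3) = t 0 + A z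
  · obtain ⟨z, hz, hpz⟩ := hp
    -- the cross neighbour `p + (t 1 − t 0) = t 1 + A z`
    set q : Sites₀ t A := ⟨t 1 + A z, 1, z, hz, rfl⟩ with hq
    have hq0 : ¬ ∃ z' ∈ Λ₀, ((q : Sites₀ t A) : E3) = t 0 + A z' := by
      rintro ⟨z', hz', h⟩; exact sublattice_ne hA hI hz' hz h.symm
    have hdist : dist (p : E3) q ≤ 11 / 10 := by
      rw [hpz, hq, dist_eq_norm]
      have : t 0 + A z - (t 1 + A z) = -(t 1 - t 0) := by abel
      rw [this, norm_neg]; exact norm_t_sub_t0_le hA hI 1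
    refine le_trans ?_ (hrow.le_tsum q fun q' _ => by positivity)
    rw [if_pos hdist]
    simp only []
    rw [if_neg hq0, sub_zero]
  · simp only []
    rw [if_neg hp, norm_zero]
    have : (0 : ℝ) ^ 2 = 0 := by norm_num
    rw [this]
    exact tsum_nonneg fun q => by positivity

end

end Summit.AtomisticToContinuum.Crystallization.Theorems.ExcessDecayLiouville

end
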